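import Summits.HodgeConjecture.HodgeConjecture.Theorems.F0P6dFormalModuleKernels   -- ★ p850166: the re-homed twin of ED. 3 72720f19f7ff8e68 (namespace KEPT ⇒ every FQN unchanged)
import HarnessLib

/-! # F0_P6d_FormalModuleKernels — ED. 4 = SHIM (rung-0 re-home; LEAD «M-72» (4) ∕ «M-78» CLASS I-b, P6d BATCH-1; dealer «L7» LA7-plan (g4))

Every declaration of ED. 3 (sha16 72720f19f7ff8e68, 152 l., sorry-free) now lives, byte for byte and under the SAME
namespace `Summit.HodgeConjecture.HodgeConjecture.Cruxes.HLiu418.F0P6dFormalModuleKernels`, in ★ `Theorems/F0P6dFormalModuleKernels.lean` (p850166).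
This module keeps its name so that importers (`rg` 07:3xZ: `F0_P6d_ConnectedBTDictionary`) and by-name readers resolve
unchanged through the import above; it declares nothing. Retired Row-4B road (superseded by road P″∕HEART); count-neutral. -/
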